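import Literature.Geometry.Riemannian.RicciNonnegInfiniteVolumeOfBishopAux
import Literature.Geometry.Riemannian.RicciNonnegInfiniteVolume
import Literature.Geometry.Riemannian.JacobianChartFormula
import Literature.Geometry.Riemannian.RiemVolumeImageLe
import Literature.Geometry.Lorentzian.VolumePositivity
import HarnessLib

/-!
# Calabi–Yau: `Ric ≥ 0`, complete, noncompact ⇒ infinite volume — Yau's argument by homothety

We prove the named fact `Literature.Geometry.Riemannian.ricciNonneg_infiniteVolume`
(`RicciNonnegInfiniteVolume.lean`; S.-T. Yau, Indiana Univ. Math. J. 25 (1976) 659–670, E. Calabi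
1975; Chow et al., *The Ricci flow: techniques and applications I*, AMS 2007, App. A, Cor. A.6:
a complete noncompact Riemannian manifold with `Ric ≥ 0` has at least linear volume growth, in
particular infinite volume) from **Bishop's radial antitonicity** of the Gram–Jacobian
`𝒥(u) = √det (g(d(exp_x)_u eᵢ, d(exp_x)_u eⱼ))` of the exponential map along minimizing
directions (`s ↦ 𝒥(s w)` is non-increasing on `(0, 1]` when `γ_w|[0,1]` is minimizing and
`Ric ≥ 0`), which enters as the hypothesis `hB` of the main theorem
`ricciNonneg_infiniteVolume_of_antitone` (proved separately in this directory, by the matrix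
Riccati comparison along minimizing geodesics).

## The argument (Yau 1976, run by homothety in `T_xM`; no polar coordinates, no cut locus)

Fix `p` and let `V₁ = Vol {d(p,·) < 1} > 0`. For `x` with `t = d(x, p) ≥ 2` let
`S ⊆ T_xM = ℝᵐ` be the Borel set of `w` with `γ_w|[0,1]` minimizing and `t - 1 < |w| < t + 1`.
Hopf–Rinow and the triangle inequality give `{d(p,·) < 1} ⊆ exp_x(S)`, so
`V₁ ≤ Vol(exp_x S) ≤ ∫_S 𝒥` (area formula, inequality half,
`riemVolume_image_le_lintegral_jacobian`). For `0 < c < 1` the set `c • S` lies in the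
injectivity domain `ID(x)`, whence
`Vol(exp_x(c • S)) = ∫_{c S} 𝒥 = cᵐ ∫_S 𝒥(c w) dw ≥ cᵐ ∫_S 𝒥 ≥ cᵐ V₁` (area formula for
injective maps `riemVolume_image_eq_lintegral_jacobian`, Haar scaling on `ℝᵐ`, and `hB`
pointwise). With `q = (t-1)/(t+1)` the sets `exp_x(q^{j+1} • S)`, `j < n`, are pairwise disjoint
Borel pieces of `M`, so `Vol M ≥ V₁ Σ_{j<n} q^{(j+1)m}` — this one-centre estimate is
`sum_mul_riemVolume_ball_le` of `RicciNonnegInfiniteVolumeOfBishopAux.lean`. Here we sum it up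
(`riemVolume_univ_eq_top_of_shells`): by Bernoulli's inequality each term is `≥ 1/2` as long as
`4 n m ≤ t + 1`, and on a connected noncompact manifold with compact closed balls there are
centres `x` with `d(x, p)` arbitrarily large, so `Vol M ≥ n V₁ / 2` for every `n`, i.e.
`Vol M = ∞`. The main theorem feeds the Gram–Jacobian of `exp_x` (area formula
`riemVolume_image_le_lintegral_jacobian` / `riemVolume_image_eq_lintegral_jacobian` with the
chart identity `sqrt_det_gram_mfderiv_eq_chart`, smoothness `contMDiff_riemannianExpMap`,
completeness `isGeodesicallyComplete_of_isCompact_closedBall`) and `hB` into it.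

## References

* S.-T. Yau, *Some function-theoretic properties of complete Riemannian manifold and their
  applications to geometry*, Indiana Univ. Math. J. 25 (1976) 659–670. [Yau1976]
* B. Chow et al., *The Ricci flow: techniques and applications, Part I*, AMS 2007, App. A,
  Cor. A.4 (Bishop–Gromov) and Cor. A.6. [ChowEtAl2007RicciFlowI]
* I. Chavel, *Riemannian Geometry: A Modern Introduction*, 2nd ed., CUP 2006, §III.4
  (Bishop's comparison theorem, Thm. III.4.3). [Chavel2006]
-/

noncomputable section

open Bundle Set Function Filter MeasureTheory Manifold
open scoped Manifold ContDiff Topology ENNReal NNReal Pointwise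

namespace Literature.Geometry.Riemannian

open Lorentzian Lorentzian.PseudoRiemannianMetric

section Sum

variable {m : ℕ} {M : Type*} [TopologicalSpace M]
  [ChartedSpace (EuclideanSpace ℝ (Fin m)) M] [IsManifold (𝓡 m) ∞ M]
  [T3Space M] [MeasurableSpace M] [BorelSpace M]
  {g : PseudoRiemannianMetric (𝓡 m) ∞ (EuclideanSpace ℝ (Fin m)) (TangentSpace (𝓡 m) : M → Type _)}

/-- **Summing the one-centre estimate over far centres: `Vol M = ∞`** (Yau 1976; Chow et al.
2007, App. A, Cor. A.6). On a connected noncompact manifold whose closed `g`-balls are compact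
there are points `x` with `d(x, p) = t` arbitrarily large (else `M` is a compact ball), and for
`4 n m ≤ t + 1` Bernoulli's inequality gives `((t-1)/(t+1))^{(j+1)m} ≥ 1/2` for `j < n`, so the
one-centre estimate yields `Vol M ≥ n Vol{d(p,·) < 1} / 2` for every `n`, while
`Vol{d(p,·) < 1} > 0` (the Riemannian measure charges open sets).
[cite: ChowEtAl2007RicciFlowI, App. A, Cor. A.6] -/
theorem riemVolume_univ_eq_top_of_shells [ConnectedSpace M] [NoncompactSpace M]
    (hg : g.IsRiemannian) (hcpl : ∀ (x : M) (r : ℝ≥0), IsCompact {y : M | g.edist hg x y ≤ r})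
    (hest : ∀ (x p : M) (t : ℝ), g.edist hg x p = ENNReal.ofReal t → 2 ≤ t → ∀ n : ℕ,
      (∑ j ∈ Finset.range n, ENNReal.ofReal (((t - 1) / (t + 1)) ^ ((j + 1) * m))) *
        g.riemVolume {y : M | g.edist hg p y < 1} ≤ g.riemVolume (univ : Set M)) :
    g.riemVolume (univ : Set M) = ⊤ := by
  by_contra hV
  -- a base point, and the positive volume of the unit ball about it
  obtain ⟨p⟩ : Nonempty M := by
    by_contra h
    haveI : IsEmpty M := not_nonempty_iff.mp h
    exact noncompact_univ M (by rw [univ_eq_empty_iff.mpr ‹IsEmpty M›]; exact isCompact_empty)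
  have hV₁ : g.riemVolume {y : M | g.edist hg p y < 1} ≠ 0 := by
    haveI : g.riemVolume.IsOpenPosMeasure := by
      rw [riemVolume_eq hg]; exact isOpenPosMeasure_riemannianMeasure _
    exact ((isOpen_setOf_edist_lt hg p 1).measure_pos g.riemVolume
      ⟨p, by rw [mem_setOf_eq, edist_self hg]; exact one_pos⟩).ne'
  have h2V : 2 * g.riemVolume (univ : Set M) ≠ ⊤ := ENNReal.mul_ne_top ENNReal.ofNat_ne_top hV
  obtain ⟨n, hn⟩ := ENNReal.exists_nat_mul_gt hV₁ h2V
  -- a far centre `x`, `d(x, p) = t ≥ 4 n m + 3`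
  set T : ℝ := 4 * n * m + 3 with hT
  have hT0 : 0 ≤ T := by rw [hT]; positivity
  obtain ⟨x, hx⟩ : ∃ x : M, ENNReal.ofReal T < g.edist hg p x := by
    by_contra h
    refine noncompact_univ M ((hcpl p T.toNNReal).of_isClosed_subset isClosed_univ ?_)
    intro y _
    exact not_lt.1 fun hy ↦ h ⟨y, hy⟩
  set t : ℝ := (g.edist hg x p).toReal with ht_def
  have ht : g.edist hg x p = ENNReal.ofReal t := (ENNReal.ofReal_toReal (edist_ne_top hg x p)).symm
  have hTt : T ≤ t := by
    have h1 : ENNReal.ofReal T ≤ g.edist hg x p := by rw [edist_comm hg x p]; exact hx.le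
    have h2 := ENNReal.toReal_mono (edist_ne_top hg x p) h1
    rwa [ENNReal.toReal_ofReal hT0] at h2
  have ht3 : 3 ≤ t := by
    have : (0 : ℝ) ≤ 4 * n * m := by positivity
    linarith
  -- each of the `n` terms of the one-centre estimate is at least `1/2`
  have hterm : ∀ j ∈ Finset.range n, (1 / 2 : ℝ) ≤ ((t - 1) / (t + 1)) ^ ((j + 1) * m) := by
    intro j hj
    have hq : (t - 1) / (t + 1) = 1 - 2 / (t + 1) := by
      field_simp
      ring
    rw [hq]
    refine half_le_pow_of_le (by linarith) ?_
    have hj' : (j : ℝ) + 1 ≤ n := by exact_mod_cast Finset.mem_range.mp hj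
    have hm0 : (0 : ℝ) ≤ m := Nat.cast_nonneg m
    calc 4 * (((j + 1) * m : ℕ) : ℝ) = 4 * ((j + 1 : ℝ) * m) := by push_cast; ring
      _ ≤ 4 * ((n : ℝ) * m) := by gcongr
      _ ≤ t + 1 := by linarith
  have hsum : (n : ℝ≥0∞) * ENNReal.ofReal (1 / 2) * g.riemVolume {y : M | g.edist hg p y < 1} ≤
      g.riemVolume (univ : Set M) := by
    calc (n : ℝ≥0∞) * ENNReal.ofReal (1 / 2) * g.riemVolume {y : M | g.edist hg p y < 1}
        = (∑ j ∈ Finset.range n, ENNReal.ofReal (1 / 2)) *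
            g.riemVolume {y : M | g.edist hg p y < 1} := by
          rw [Finset.sum_const, Finset.card_range, nsmul_eq_mul]
      _ ≤ (∑ j ∈ Finset.range n, ENNReal.ofReal (((t - 1) / (t + 1)) ^ ((j + 1) * m))) *
            g.riemVolume {y : M | g.edist hg p y < 1} := by
          gcongr with j hj
          exact hterm j hj
      _ ≤ g.riemVolume (univ : Set M) := hest x p t ht (by linarith) n
  have h22 : (2 : ℝ≥0∞) * ENNReal.ofReal (1 / 2) = 1 := by
    rw [← ENNReal.ofReal_ofNat 2, ← ENNReal.ofReal_mul (by norm_num)]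
    norm_num
  have hle : (n : ℝ≥0∞) * g.riemVolume {y : M | g.edist hg p y < 1} ≤
      2 * g.riemVolume (univ : Set M) := by
    calc (n : ℝ≥0∞) * g.riemVolume {y : M | g.edist hg p y < 1}
        = 2 * ((n : ℝ≥0∞) * ENNReal.ofReal (1 / 2) *
            g.riemVolume {y : M | g.edist hg p y < 1}) := by
          rw [mul_comm (n : ℝ≥0∞) (ENNReal.ofReal (1 / 2)), mul_assoc, ← mul_assoc 2, h22,
            one_mul]
      _ ≤ 2 * g.riemVolume (univ : Set M) := by gcongr
  exact absurd hn (not_lt.mpr hle)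

end Sum

/-! ### Calabi–Yau from Bishop's radial antitonicity of the Gram–Jacobian of `exp` -/

/-- **Calabi–Yau: a complete connected noncompact Riemannian manifold with `Ric ≥ 0` has
infinite volume, from Bishop's comparison in infinitesimal form** (Yau 1976; Calabi 1975; Chow
et al. 2007, App. A, Cor. A.6 with Cor. A.4). The hypothesis `hB` is Bishop's theorem along
minimizing directions (Chavel 2006, Thm. III.4.3; Chow et al. 2007, (A.9)–(A.10)): for
`Ric ≥ 0` and `γ_v|[0,1]` minimizing, `s ↦ 𝒥(s v)` is non-increasing on `(0, 1]`, where
`𝒥(u) = √det (g(d(exp_p)_u eᵢ, d(exp_p)_u eⱼ))ᵢⱼ` is the Gram–Jacobian of `exp_p` in the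
standard basis of `T_pM = ℝᵐ`. Given `hB`, the named fact `ricciNonneg_infiniteVolume` follows
by Yau's argument run by homothety in `T_xM` (`sum_mul_riemVolume_ball_le`,
`riemVolume_univ_eq_top_of_shells`), the area formula for `exp_x`
(`riemVolume_image_le_lintegral_jacobian`, `riemVolume_image_eq_lintegral_jacobian`, with the
chart identity `sqrt_det_gram_mfderiv_eq_chart`) and Hopf–Rinow
(`isGeodesicallyComplete_of_isCompact_closedBall`).
[cite: Yau1976, Thm. (volume growth), pp. 659–670] -/
theorem ricciNonneg_infiniteVolume_of_antitone
    (hB : ∀ {m : ℕ} {M : Type} [TopologicalSpace M] [T2Space M] [SecondCountableTopology M]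
      [ChartedSpace (EuclideanSpace ℝ (Fin m)) M] [IsManifold (𝓡 m) ∞ M] [T3Space M]
      [MeasurableSpace M] [BorelSpace M] [ConnectedSpace M]
      (g : PseudoRiemannianMetric (𝓡 m) ∞ (EuclideanSpace ℝ (Fin m))
        (TangentSpace (𝓡 m) : M → Type _)) [g.HasLeviCivita] (hg : g.IsRiemannian),
      (∀ (x : M) (r : ℝ≥0), IsCompact {y : M | g.edist hg x y ≤ r}) →
      (∀ (x : M) (w : TangentSpace (𝓡 m) x), 0 ≤ g.ricci x w w) →
      ∀ (p : M) (v : EuclideanSpace ℝ (Fin m)), IsMinimizingUpTo g hg p v 1 →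
        AntitoneOn (fun s : ℝ ↦ Real.sqrt (Matrix.det (Matrix.of fun i j : Fin m ↦
          g.val (riemannianExpMap g p (s • v))
            (mfderiv 𝓘(ℝ, EuclideanSpace ℝ (Fin m)) (𝓡 m)
              (fun u : EuclideanSpace ℝ (Fin m) ↦ riemannianExpMap g p u) (s • v)
              (EuclideanSpace.single i (1 : ℝ)))
            (mfderiv 𝓘(ℝ, EuclideanSpace ℝ (Fin m)) (𝓡 m)
              (fun u : EuclideanSpace ℝ (Fin m) ↦ riemannianExpMap g p u) (s • v)
              (EuclideanSpace.single j (1 : ℝ)))))) (Ioc (0 : ℝ) 1)) :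
    ricciNonneg_infiniteVolume := by
  intro m M _ _ _ _ _ _ _ _ _ _ g _ hg hcpl hRic
  have hk1 : ((1 : ℕ∞) : ℕ∞ω) + 1 ≤ ((⊤ : ℕ∞) : ℕ∞ω) := by
    rw [show ((1 : ℕ∞) : ℕ∞ω) + 1 = 2 by norm_num]
    exact WithTop.coe_le_coe.2 le_top
  haveI : CovariantDerivative.ContMDiffCovariantDerivative g.leviCivita 1 :=
    ⟨g.isLocallyContMDiff_leviCivita_holds 1 hk1 univ isOpen_univ⟩
  have hc : IsGeodesicallyComplete g.leviCivita :=
    isGeodesicallyComplete_of_isCompact_closedBall hg hcpl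
  refine riemVolume_univ_eq_top_of_shells hg hcpl fun x p t ht ht2 n ↦ ?_
  have hF : ContMDiff 𝓘(ℝ, EuclideanSpace ℝ (Fin m)) (𝓡 m) 1
      (fun u : EuclideanSpace ℝ (Fin m) ↦ riemannianExpMap g x u) :=
    (contMDiff_riemannianExpMap g le_rfl hc x).of_le (WithTop.coe_le_coe.mpr le_top)
  refine sum_mul_riemVolume_ball_le hg hc x p ht ht2
    (fun A hA ↦ riemVolume_image_le_lintegral_jacobian g hg hF
      (fun u q hq ↦ sqrt_det_gram_mfderiv_eq_chart g hg hF.contMDiffAt q hq) hA)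
    (fun A hA hinj ↦ riemVolume_image_eq_lintegral_jacobian g hg hF
      (fun u q hq ↦ sqrt_det_gram_mfderiv_eq_chart g hg hF.contMDiffAt q hq) hA hinj)
    (fun w hw c hc0 hc1 ↦ ?_) n
  have h := hB g hg hcpl hRic x w hw ⟨hc0, hc1⟩ ⟨one_pos, le_rfl⟩ hc1
  beta_reduce at h
  rw [one_smul] at h
  exact ENNReal.ofReal_le_ofReal h

end Literature.Geometry.Riemannian

end
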